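/-
Copyright (c) 2026 the pub-hodgecm-mathlib formalisation cell (harness21).  Prover seat hodgecm-mathlib-A-p12 (g24), 2026-09-02.  «S3-ram» seeding wave (LEAD F0P3a-plan (g12∕g13);
owner F0P3a-p06 (g15); (Cnt2′) chair F0P3a-p07 (g14)): organ (B-ii) «SHELL CLASS LAW» of the (α₂) TYPE-(2) line, file 2a «THE FLIP WITH PRESCRIBED RESIDUE AND ITS UNITARY
CORRECTION» (design memo `F0/P3a/A-p12/g24/DESIGN-Bii-ShellClassLaw.A-p12g24.md`; ⊇ ★ p847601 file 1).  Kernel lane, `--supports stmt-HodgeConjecture-24833`.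
-/
import Literature.NumberTheory.Rogawski1990.DepthZeroKappaTransferTypeTwoRamifiedShellFlip        -- ★ p847601 (this seat) file 1: the similitude identity, `conj_mem_unitaryGroupOfForm_of_similitude`
import Literature.NumberTheory.Rogawski1990.DepthZeroKappaTransferTypeTwoRamifiedDepthBallsTop     -- ★ p847580 (this seat): ⊇ ★ `exists_eq_toPlace_add_toPlace_mul`, `valued_toPlace_add_toPlace_mul`
import Literature.NumberTheory.Automorphic.HermitianLatticeTreeTransitiveRamifiedFlags             -- ★ (hA) `forall_isSelfDualLattice_exists_latt_eq_of_ramified_antidiag`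
import Literature.NumberTheory.Automorphic.FixedCosetsStableLattices                               -- ★ `span_range_transpose_eq_iff` (`latt g = latt g′ ⟺ g⁻¹g′ ∈ GL₂(𝒪)`)
import HarnessLib

/-!
# The class-flipping similitude with PRESCRIBED residual multiplier, and its unitary correction `k₀ ∈ U` with `k₀⁻¹X₀ ∈ GL₂(𝒪_w)`
# (Labesse–Langlands 1979 §2; Rogawski 1990 §4.9; Jacobowitz 1962 §8)

Topic `NumberTheory/Rogawski1990`; namespace `Literature.NumberTheory.Automorphic.UnitaryGroup`.  THEOREMS ONLY (no definition, no instance, no notation, no named fact,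
no `sorry`); kernel lane `--supports stmt-HodgeConjecture-24833`.  Cell `pub/hodgecm-mathlib` (D-0151), crux H413; «S3-ram» (count-neutral); seat A-p12 (g24).  HONEST LABEL:
HC_CM is proved only modulo the cell's 2 remaining named inputs (hLiu418 24832, h413 24833) until rung 0 closes; nothing printed is asserted here.

THE MATHEMATICS (organ (B-ii), file 2a; file 1 = ★ `exists_classFlip_similitude`).  (§1) The residual norm form `x² − ε̄₀y²` of `𝓀(√ε̄₀)∕𝓀` is onto ALL of `𝓀`
(Mathlib `FiniteField.exists_root_sum_quadratic`), so for every unit `p ∈ 𝒪_v` there are integral `a, b` with `a² − ε₀b² ≡ p (mod 𝔭_v)`; hence (§2) a `g₀ ∈ L⁺_v[g]`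
commuting with `g` whose determinant is a unit of PRESCRIBED residue `p̄`, and (§3) a similitude `X₀ = D_ϖ⁻¹ι(g₀)D_ϖ` of `(L_w², J)` commuting with `u`, normalising
`U(σ_w, Φ₂)`, with unit multiplier `ν`, `|ν − p|_v < 1` — in particular (§3, `exists_classFlip_similitude_of_unit`) for every unit `c ∈ 𝒪_w` one with `|ι(ν) − c|_w < 1`
(`𝓀_w = 𝓀_v` at a ramified place: `c = ιp + ιq·ϖ`, ★ `exists_eq_toPlace_add_toPlace_mul`).  (§4) Since `ᵗσ(X₀)JX₀ = ι(ν)J` is unimodular, `latt X₀` is a SELF-DUAL lattice, so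
by the transitivity ★ (hA) there is `k₀ ∈ U(σ_w, Φ₂)` with `latt k₀ = latt X₀`, i.e. `P := k₀⁻¹X₀ ∈ GL₂(𝒪_w)` (★ `span_range_transpose_eq_iff`): the map `h ↦ X₀hX₀⁻¹k₀`
is then a self-map of `U` compatible with `K⁰ = U ∩ GL₂(𝒪_w)`-cosets whose effect on monodromies is conjugation by the INTEGRAL similitude `P` (file 2b).

* §1 `valuation_lt_one_of_residue_eq_zero`, `exists_residual_norm_residue`.
* §2 `exists_commuting_det_residue`.
* §3 `exists_classFlip_similitude_of_residue`, `exists_toPlace_unit_near`, **`exists_classFlip_similitude_of_unit`**.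
* §4 `isUnimodular₂_smul_antidiag`, **`exists_unitary_inv_mul_mem_glInt_of_similitude`**.

## References
* [LabesseLanglands1979] J.-P. Labesse, R. P. Langlands, *L-indistinguishability for SL(2)*, Canad. J. Math. 31 (1979): §2 p. 7.
* [Rogawski1990] J. D. Rogawski, *Automorphic Representations of Unitary Groups in Three Variables* (1990): §4.9 pp. 54–56.
* [Jacobowitz1962] R. Jacobowitz, *Hermitian forms over local fields*, Amer. J. Math. 84 (1962): §7–§8.
* [Serre1979] J.-P. Serre, *Local Fields*, GTM 67 (1979): Ch. XIV §4, Ch. II §2.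
-/

set_option autoImplicit false

noncomputable section

open MeasureTheory Measure Set NumberField IsDedekindDomain Matrix ValuativeRel MulAction Finset Polynomial
open scoped ValuativeRel Matrix MatrixGroups WithZero

namespace Literature.NumberTheory.Automorphic.UnitaryGroup

open Literature.NumberTheory.Rogawski1990 Literature.NumberTheory.Automorphic Literature.NumberTheory.Automorphic.IntegralReduction
open Literature.NumberTheory.Automorphic.HermitianLatticeTree Literature.GroupTheory Literature.NumberTheory.GaloisRepresentations

/-! ## §1 The residual norm form is onto: prescribed residue -/

section Residue

variable (L : Type) [Field L] [NumberField L] [IsCMField L] (v : HeightOneSpectrum (𝓞 ↥(maximalRealSubfield L)))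

omit [IsCMField L] in
/-- An integer of residue `0` has valuation `< 1`. [cite: Serre1979, Ch. II §2] -/
theorem valuation_lt_one_of_residue_eq_zero (d : 𝒪[(v.adicCompletion ↥(maximalRealSubfield L))])
    (h : IsLocalRing.residue 𝒪[(v.adicCompletion ↥(maximalRealSubfield L))] d = 0) : valuation (v.adicCompletion ↥(maximalRealSubfield L)) (d : (v.adicCompletion ↥(maximalRealSubfield L))) < 1 := by
  refine lt_of_le_of_ne ((Valuation.mem_integer_iff _ _).1 d.2) fun h1 => ?_
  rw [IsLocalRing.residue_eq_zero_iff, IsLocalRing.mem_maximalIdeal, mem_nonunits_iff] at h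
  exact h (((Valuation.integer.integers (valuation (v.adicCompletion ↥(maximalRealSubfield L)))).isUnit_iff_valuation_eq_one).2 h1)

set_option maxHeartbeats 400000 in
omit [IsCMField L] in
/-- **THE RESIDUAL NORM FORM IS ONTO**: for a unit `ε₀` of non-square residue, `|2|_v = 1` and any unit `p ∈ 𝒪_v` there are `a, b ∈ 𝒪_v` with `a² − ε₀b²` a unit and
`|a² − ε₀b² − p|_v < 1` (Mathlib `FiniteField.exists_root_sum_quadratic` on the odd residue field: `x² − ε̄₀y² = p̄` is soluble). [cite: Serre1979, Ch. XIV §4] -/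
theorem exists_residual_norm_residue (h2 : Valued.v (2 : (v.adicCompletion ↥(maximalRealSubfield L))) = 1)
    {ε₀ : (v.adicCompletion ↥(maximalRealSubfield L))} (hε₀ : ε₀ ∈ 𝒪[(v.adicCompletion ↥(maximalRealSubfield L))]) (hns : ∀ x : (v.adicCompletion ↥(maximalRealSubfield L)), x ∈ 𝒪[(v.adicCompletion ↥(maximalRealSubfield L))] → valuation (v.adicCompletion ↥(maximalRealSubfield L)) (x ^ 2 - ε₀) = 1)
    {p : (v.adicCompletion ↥(maximalRealSubfield L))} (hp : valuation (v.adicCompletion ↥(maximalRealSubfield L)) p = 1) :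
    ∃ a b : (v.adicCompletion ↥(maximalRealSubfield L)), a ∈ 𝒪[(v.adicCompletion ↥(maximalRealSubfield L))] ∧ b ∈ 𝒪[(v.adicCompletion ↥(maximalRealSubfield L))] ∧ valuation (v.adicCompletion ↥(maximalRealSubfield L)) (a ^ 2 - ε₀ * b ^ 2) = 1 ∧
      valuation (v.adicCompletion ↥(maximalRealSubfield L)) (a ^ 2 - ε₀ * b ^ 2 - p) < 1 := by
  classical
  haveI := finite_residueField_integer_adicCompletion L v
  letI : Fintype 𝓀[(v.adicCompletion ↥(maximalRealSubfield L))] := Fintype.ofFinite _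
  have hchar : ringChar 𝓀[(v.adicCompletion ↥(maximalRealSubfield L))] ≠ 2 := by
    intro h
    have h2' : red (2 : (v.adicCompletion ↥(maximalRealSubfield L))) ≠ 0 := red_ne_zero_of_valuation_eq_one ((v_eq_one_iff_valuation_eq_one _).1 h2)
    rw [red_two] at h2'
    apply h2'
    have h' : ((ringChar 𝓀[(v.adicCompletion ↥(maximalRealSubfield L))] : ℕ) : 𝓀[(v.adicCompletion ↥(maximalRealSubfield L))]) = 0 := ringChar.Nat.cast_ringChar
    rw [h] at h'
    exact_mod_cast h'
  have hodd : Fintype.card 𝓀[(v.adicCompletion ↥(maximalRealSubfield L))] % 2 = 1 := FiniteField.odd_card_of_char_ne_two hchar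
  -- the residues `ē ≠ 0` of `ε₀` and `p̄ ≠ 0` of `p`
  set e : 𝒪[(v.adicCompletion ↥(maximalRealSubfield L))] := ⟨ε₀, hε₀⟩ with he
  have hebar : IsLocalRing.residue 𝒪[(v.adicCompletion ↥(maximalRealSubfield L))] e ≠ 0 := by
    intro h0
    have h1 := hns 0 (zero_mem _)
    rw [zero_pow two_ne_zero, zero_sub, Valuation.map_neg] at h1
    have : red ε₀ ≠ 0 := red_ne_zero_of_valuation_eq_one h1
    rw [show ε₀ = ((e : 𝒪[(v.adicCompletion ↥(maximalRealSubfield L))]) : (v.adicCompletion ↥(maximalRealSubfield L))) from rfl, red_coe] at this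
    exact this h0
  set p' : 𝒪[(v.adicCompletion ↥(maximalRealSubfield L))] := ⟨p, (Valuation.mem_integer_iff _ _).2 hp.le⟩ with hp'
  have hpbar : IsLocalRing.residue 𝒪[(v.adicCompletion ↥(maximalRealSubfield L))] p' ≠ 0 := by
    have : red p ≠ 0 := red_ne_zero_of_valuation_eq_one hp
    rwa [show p = ((p' : 𝒪[(v.adicCompletion ↥(maximalRealSubfield L))]) : (v.adicCompletion ↥(maximalRealSubfield L))) from rfl, red_coe] at this
  -- solve `x² + (−ē y² − p̄) = 0` in the residue field
  have hf : (X ^ 2 : 𝓀[(v.adicCompletion ↥(maximalRealSubfield L))][X]).degree = 2 := by rw [degree_X_pow]; rfl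
  have hg : (C (-IsLocalRing.residue 𝒪[(v.adicCompletion ↥(maximalRealSubfield L))] e) * X ^ 2 - C (IsLocalRing.residue 𝒪[(v.adicCompletion ↥(maximalRealSubfield L))] p') : 𝓀[(v.adicCompletion ↥(maximalRealSubfield L))][X]).degree = 2 := by
    rw [degree_sub_eq_left_of_degree_lt] <;> rw [degree_C_mul_X_pow 2 (neg_ne_zero.2 hebar)]
    · rfl
    · exact lt_of_le_of_lt degree_C_le (by decide)
  obtain ⟨abar, bbar, hab⟩ := FiniteField.exists_root_sum_quadratic hf hg hodd
  simp only [eval_pow, eval_X, eval_sub, eval_mul, eval_C] at hab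
  obtain ⟨a, ha⟩ := IsLocalRing.residue_surjective abar
  obtain ⟨b, hb⟩ := IsLocalRing.residue_surjective bbar
  have hres : IsLocalRing.residue 𝒪[(v.adicCompletion ↥(maximalRealSubfield L))] (a ^ 2 - e * b ^ 2) = IsLocalRing.residue 𝒪[(v.adicCompletion ↥(maximalRealSubfield L))] p' := by
    rw [map_sub, map_mul, map_pow, map_pow, ha, hb]; linear_combination hab
  have hcoe : ((a ^ 2 - e * b ^ 2 : 𝒪[(v.adicCompletion ↥(maximalRealSubfield L))]) : (v.adicCompletion ↥(maximalRealSubfield L))) = (a : (v.adicCompletion ↥(maximalRealSubfield L))) ^ 2 - ε₀ * (b : (v.adicCompletion ↥(maximalRealSubfield L))) ^ 2 := by push_cast; rfl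
  refine ⟨a, b, a.2, b.2, ?_, ?_⟩
  · rw [← hcoe]
    refine valuation_eq_one_of_red_ne_zero (a ^ 2 - e * b ^ 2).2 ?_
    rw [red_coe, hres]
    exact hpbar
  · have hcoe' : (a : (v.adicCompletion ↥(maximalRealSubfield L))) ^ 2 - ε₀ * (b : (v.adicCompletion ↥(maximalRealSubfield L))) ^ 2 - p = (((a ^ 2 - e * b ^ 2 - p' : 𝒪[(v.adicCompletion ↥(maximalRealSubfield L))])) : (v.adicCompletion ↥(maximalRealSubfield L))) := by push_cast; rfl
    rw [hcoe']
    refine valuation_lt_one_of_residue_eq_zero L v _ ?_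
    rw [map_sub, hres, sub_self]

/-! ## §2 A commuting element with determinant of prescribed residue -/

omit [IsCMField L] in
/-- **A COMMUTING ELEMENT WITH DETERMINANT OF PRESCRIBED RESIDUE.**  For `g ∈ M₂(L⁺_v)` with `tr g = t`, `det g = d`, `t² − 4d = ε₀z²` (`ε₀` a unit of non-square residue,
`z ≠ 0`, `|2| = 1`) and any unit `p ∈ 𝒪_v` there is `g₀ = a·1 + b′·(g − ½t·1)` with `g₀·g = g·g₀`, `|det g₀|_v = 1` and `|det g₀ − p|_v < 1` (`det g₀ = a² − ε₀b²`, §1).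
[cite: LabesseLanglands1979, §2 p. 7] [cite: Serre1979, Ch. XIV §4] -/
theorem exists_commuting_det_residue (h2 : Valued.v (2 : (v.adicCompletion ↥(maximalRealSubfield L))) = 1)
    {ε₀ : (v.adicCompletion ↥(maximalRealSubfield L))} (hε₀ : ε₀ ∈ 𝒪[(v.adicCompletion ↥(maximalRealSubfield L))]) (hns : ∀ x : (v.adicCompletion ↥(maximalRealSubfield L)), x ∈ 𝒪[(v.adicCompletion ↥(maximalRealSubfield L))] → valuation (v.adicCompletion ↥(maximalRealSubfield L)) (x ^ 2 - ε₀) = 1)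
    {p : (v.adicCompletion ↥(maximalRealSubfield L))} (hp : valuation (v.adicCompletion ↥(maximalRealSubfield L)) p = 1)
    (g : Matrix (Fin 2) (Fin 2) (v.adicCompletion ↥(maximalRealSubfield L))) {t d z : (v.adicCompletion ↥(maximalRealSubfield L))} (htr : g.trace = t) (hdet : g.det = d) (hz : z ≠ 0) (hD : t ^ 2 - 4 * d = ε₀ * z ^ 2) :
    ∃ g₀ : Matrix (Fin 2) (Fin 2) (v.adicCompletion ↥(maximalRealSubfield L)), g₀ * g = g * g₀ ∧ valuation (v.adicCompletion ↥(maximalRealSubfield L)) g₀.det = 1 ∧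
      valuation (v.adicCompletion ↥(maximalRealSubfield L)) (g₀.det - p) < 1 := by
  have h20 : (2 : (v.adicCompletion ↥(maximalRealSubfield L))) ≠ 0 := fun h0 => zero_ne_one (by rw [h0, map_zero] at h2; exact h2)
  obtain ⟨a, b, -, -, hunit, hres⟩ := exists_residual_norm_residue L v h2 hε₀ hns hp
  have hdet₀ : (a • (1 : Matrix (Fin 2) (Fin 2) (v.adicCompletion ↥(maximalRealSubfield L))) + (2 * b / z) • (g - (t / 2) • (1 : Matrix (Fin 2) (Fin 2) (v.adicCompletion ↥(maximalRealSubfield L))))).det =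
      a ^ 2 - ε₀ * b ^ 2 := by
    set ν : (v.adicCompletion ↥(maximalRealSubfield L)) := (2 : (v.adicCompletion ↥(maximalRealSubfield L)))⁻¹ with hνdef
    set z' : (v.adicCompletion ↥(maximalRealSubfield L)) := z⁻¹ with hz'def
    have hν : ν * 2 = 1 := inv_mul_cancel₀ h20
    have hzz : z * z' = 1 := mul_inv_cancel₀ hz
    rw [show t / 2 = t * ν from div_eq_mul_inv t 2, show 2 * b / z = 2 * b * z' from div_eq_mul_inv _ _]
    rw [Matrix.trace_fin_two] at htr
    rw [Matrix.det_fin_two] at hdet ⊢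
    simp only [Matrix.add_apply, Matrix.smul_apply, Matrix.sub_apply, Matrix.one_apply_eq, Matrix.one_apply_ne (show (0 : Fin 2) ≠ 1 by decide),
      Matrix.one_apply_ne (show (1 : Fin 2) ≠ 0 by decide), smul_eq_mul, mul_one, mul_zero, sub_zero]
    linear_combination (a * (2 * b * z') - (2 * b * z') ^ 2 * t * ν) * htr + (2 * b * z') ^ 2 * hdet - b ^ 2 * z' ^ 2 * hD +
      (-(a * (2 * b * z') * t) + b ^ 2 * z' ^ 2 * t ^ 2 * (ν * 2 - 1)) * hν - ε₀ * b ^ 2 * (z * z' + 1) * hzz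
  refine ⟨a • (1 : Matrix (Fin 2) (Fin 2) (v.adicCompletion ↥(maximalRealSubfield L))) + (2 * b / z) • (g - (t / 2) • (1 : Matrix (Fin 2) (Fin 2) (v.adicCompletion ↥(maximalRealSubfield L)))), ?_, ?_, ?_⟩
  · rw [Matrix.add_mul, Matrix.mul_add, Matrix.smul_mul, Matrix.mul_smul, Matrix.one_mul, Matrix.mul_one, Matrix.smul_mul, Matrix.mul_smul, Matrix.sub_mul, Matrix.mul_sub,
      Matrix.smul_mul, Matrix.mul_smul, Matrix.one_mul, Matrix.mul_one]
  · rw [hdet₀]; exact hunit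
  · rw [hdet₀]; exact hres

end Residue

/-! ## §3 The class-flipping similitude with prescribed residual multiplier -/

section Flip

variable (L : Type) [Field L] [NumberField L] [IsCMField L] (v : HeightOneSpectrum (𝓞 ↥(maximalRealSubfield L)))
  (w : PlacesOver L v) (hw : IsCMField.complexConj L • w.1 = w.1)

include hw in
/-- **THE CLASS-FLIPPING SIMILITUDE WITH PRESCRIBED RESIDUE.**  For `u ∈ U(σ_w, Φ₂)(L_w)` with (W1) descent `D_ϖ u D_ϖ⁻¹ = s·ι(g)`, `tr²g − 4 det g = ε₀z²` (`ε₀` a unit of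
non-square residue, `z ≠ 0`, `|2|_v = 1`) and ANY unit `p ∈ 𝒪_v`: there are `X₀ ∈ GL₂(L_w)` and `ν ∈ L⁺_v` with `ᵗσ_w(X₀)·J·X₀ = ι(ν)·J` (`J = antidiag(1,1)`), `|ν|_v = 1`,
`|ν − p|_v < 1`, `X₀·u = u·X₀`, and `X₀ h X₀⁻¹ ∈ U(σ_w, Φ₂)` for every `h ∈ U(σ_w, Φ₂)` — namely `X₀ = D_ϖ⁻¹·ι(g₀)·D_ϖ` for the commuting `g₀` of §2 (★ file 1 is the case of a
non-square residue). [cite: LabesseLanglands1979, §2 p. 7] [cite: Rogawski1990, §4.9 p. 55] [cite: Serre1979, Ch. XIV §4] -/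
theorem exists_classFlip_similitude_of_residue (h2v : Valued.v (2 : (v.adicCompletion ↥(maximalRealSubfield L))) = 1)
    (ϖ : (w.1.adicCompletion L)ˣ) (hσϖ : galAdicCompletionMap (L := L) (IsCMField.complexConj L) hw (ϖ : (w.1.adicCompletion L)) = -(ϖ : (w.1.adicCompletion L)))
    (u : ↥(unitaryGroupOfForm (galAdicCompletionMap (L := L) (IsCMField.complexConj L) hw) (placeForm (Matrix.of fun i j : Fin 2 => if i.val + j.val + 1 = 2 then (1 : L) else 0) w.1)))
    {s : (w.1.adicCompletion L)} {g : GL (Fin 2) (v.adicCompletion ↥(maximalRealSubfield L))}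
    (hsg : Matrix.diagonal ![1, (ϖ : (w.1.adicCompletion L))] * ((u : GL (Fin 2) (w.1.adicCompletion L)) : Matrix (Fin 2) (Fin 2) (w.1.adicCompletion L)) * Matrix.diagonal ![1, (ϖ : (w.1.adicCompletion L))⁻¹] =
      s • (g : Matrix (Fin 2) (Fin 2) (v.adicCompletion ↥(maximalRealSubfield L))).map (toPlace v w))
    {ε₀ : (v.adicCompletion ↥(maximalRealSubfield L))} (hε₀ : ε₀ ∈ 𝒪[(v.adicCompletion ↥(maximalRealSubfield L))]) (hns : ∀ x : (v.adicCompletion ↥(maximalRealSubfield L)), x ∈ 𝒪[(v.adicCompletion ↥(maximalRealSubfield L))] → valuation (v.adicCompletion ↥(maximalRealSubfield L)) (x ^ 2 - ε₀) = 1)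
    {z : (v.adicCompletion ↥(maximalRealSubfield L))} (hz : z ≠ 0) (hD : (g : Matrix (Fin 2) (Fin 2) (v.adicCompletion ↥(maximalRealSubfield L))).trace ^ 2 - 4 * (g : Matrix (Fin 2) (Fin 2) (v.adicCompletion ↥(maximalRealSubfield L))).det = ε₀ * z ^ 2)
    {p : (v.adicCompletion ↥(maximalRealSubfield L))} (hp : valuation (v.adicCompletion ↥(maximalRealSubfield L)) p = 1) :
    ∃ (X₀ : GL (Fin 2) (w.1.adicCompletion L)) (ν : (v.adicCompletion ↥(maximalRealSubfield L))),
      ((X₀ : Matrix (Fin 2) (Fin 2) (w.1.adicCompletion L)).map (galAdicCompletionMap (L := L) (IsCMField.complexConj L) hw))ᵀ * !![(0 : (w.1.adicCompletion L)), 1; 1, 0] * (X₀ : Matrix (Fin 2) (Fin 2) (w.1.adicCompletion L)) =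
          toPlace v w ν • !![(0 : (w.1.adicCompletion L)), 1; 1, 0] ∧
      valuation (v.adicCompletion ↥(maximalRealSubfield L)) ν = 1 ∧ valuation (v.adicCompletion ↥(maximalRealSubfield L)) (ν - p) < 1 ∧
      (X₀ : Matrix (Fin 2) (Fin 2) (w.1.adicCompletion L)) * ((u : GL (Fin 2) (w.1.adicCompletion L)) : Matrix (Fin 2) (Fin 2) (w.1.adicCompletion L)) = ((u : GL (Fin 2) (w.1.adicCompletion L)) : Matrix (Fin 2) (Fin 2) (w.1.adicCompletion L)) * (X₀ : Matrix (Fin 2) (Fin 2) (w.1.adicCompletion L)) ∧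
      ∀ h : GL (Fin 2) (w.1.adicCompletion L), h ∈ unitaryGroupOfForm (galAdicCompletionMap (L := L) (IsCMField.complexConj L) hw) (placeForm (Matrix.of fun i j : Fin 2 => if i.val + j.val + 1 = 2 then (1 : L) else 0) w.1) →
        X₀ * h * X₀⁻¹ ∈ unitaryGroupOfForm (galAdicCompletionMap (L := L) (IsCMField.complexConj L) hw) (placeForm (Matrix.of fun i j : Fin 2 => if i.val + j.val + 1 = 2 then (1 : L) else 0) w.1) := by
  have hϖ0 : (ϖ : (w.1.adicCompletion L)) ≠ 0 := ϖ.ne_zero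
  have hσι : ∀ x, galAdicCompletionMap (L := L) (IsCMField.complexConj L) hw (toPlace v w x) = toPlace v w x :=
    fun x => galAdicCompletionMap_toPlace (IsCMField.complexConj L) w w hw x
  obtain ⟨g₀, hcomm, hdet1, hres⟩ := exists_commuting_det_residue L v h2v hε₀ hns hp (g : Matrix (Fin 2) (Fin 2) (v.adicCompletion ↥(maximalRealSubfield L))) rfl rfl hz hD
  -- `X₀ = D⁻¹ ι(g₀) D`
  set X : Matrix (Fin 2) (Fin 2) (w.1.adicCompletion L) := Matrix.diagonal ![1, (ϖ : (w.1.adicCompletion L))⁻¹] * g₀.map (toPlace v w) * Matrix.diagonal ![1, (ϖ : (w.1.adicCompletion L))] with hXdef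
  have hsim := formCongr_conj_diagonal_map (toPlace v w) (galAdicCompletionMap (L := L) (IsCMField.complexConj L) hw) hσι hσϖ hϖ0 g₀
  have hdet0 : g₀.det ≠ 0 := fun h0 => by rw [h0, map_zero] at hdet1; exact zero_ne_one hdet1
  have hXdet : X.det ≠ 0 := by
    rw [hXdef, Matrix.det_mul, Matrix.det_mul, ← RingHom.mapMatrix_apply, ← RingHom.map_det, Matrix.det_diagonal, Matrix.det_diagonal]
    simp [Fin.prod_univ_two, hϖ0, hdet0]
  set X₀ : GL (Fin 2) (w.1.adicCompletion L) := Matrix.GeneralLinearGroup.mk'' X (isUnit_iff_ne_zero.2 hXdet) with hX₀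
  have hX₀coe : (X₀ : Matrix (Fin 2) (Fin 2) (w.1.adicCompletion L)) = X := rfl
  -- `u = D⁻¹ (s ι g) D`
  have hD := diagonal_inv_mul_diagonal (E := (w.1.adicCompletion L)) hϖ0
  have hD' := diagonal_mul_diagonal_inv (E := (w.1.adicCompletion L)) hϖ0
  have huv : ((u : GL (Fin 2) (w.1.adicCompletion L)) : Matrix (Fin 2) (Fin 2) (w.1.adicCompletion L)) = Matrix.diagonal ![1, (ϖ : (w.1.adicCompletion L))⁻¹] * (s • (g : Matrix (Fin 2) (Fin 2) (v.adicCompletion ↥(maximalRealSubfield L))).map (toPlace v w)) * Matrix.diagonal ![1, (ϖ : (w.1.adicCompletion L))] := by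
    rw [← hsg]
    calc ((u : GL (Fin 2) (w.1.adicCompletion L)) : Matrix (Fin 2) (Fin 2) (w.1.adicCompletion L))
        = (Matrix.diagonal ![1, (ϖ : (w.1.adicCompletion L))⁻¹] * Matrix.diagonal ![1, (ϖ : (w.1.adicCompletion L))]) * ((u : GL (Fin 2) (w.1.adicCompletion L)) : Matrix (Fin 2) (Fin 2) (w.1.adicCompletion L)) *
            (Matrix.diagonal ![1, (ϖ : (w.1.adicCompletion L))⁻¹] * Matrix.diagonal ![1, (ϖ : (w.1.adicCompletion L))]) := by rw [hD, Matrix.one_mul, Matrix.mul_one]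
      _ = _ := by simp only [Matrix.mul_assoc]
  refine ⟨X₀, g₀.det, by rw [hX₀coe, hXdef]; exact hsim, hdet1, hres, ?_, fun h hh => ?_⟩
  · -- commutation
    rw [hX₀coe, hXdef, huv]
    have hιcomm : g₀.map (toPlace v w) * (s • (g : Matrix (Fin 2) (Fin 2) (v.adicCompletion ↥(maximalRealSubfield L))).map (toPlace v w)) = (s • (g : Matrix (Fin 2) (Fin 2) (v.adicCompletion ↥(maximalRealSubfield L))).map (toPlace v w)) * g₀.map (toPlace v w) := by
      rw [Matrix.mul_smul, Matrix.smul_mul, ← Matrix.map_mul, hcomm, Matrix.map_mul]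
    calc Matrix.diagonal ![1, (ϖ : (w.1.adicCompletion L))⁻¹] * g₀.map (toPlace v w) * Matrix.diagonal ![1, (ϖ : (w.1.adicCompletion L))] *
          (Matrix.diagonal ![1, (ϖ : (w.1.adicCompletion L))⁻¹] * (s • (g : Matrix (Fin 2) (Fin 2) (v.adicCompletion ↥(maximalRealSubfield L))).map (toPlace v w)) * Matrix.diagonal ![1, (ϖ : (w.1.adicCompletion L))])
        = Matrix.diagonal ![1, (ϖ : (w.1.adicCompletion L))⁻¹] * (g₀.map (toPlace v w) * ((Matrix.diagonal ![1, (ϖ : (w.1.adicCompletion L))] * Matrix.diagonal ![1, (ϖ : (w.1.adicCompletion L))⁻¹]) *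
            (s • (g : Matrix (Fin 2) (Fin 2) (v.adicCompletion ↥(maximalRealSubfield L))).map (toPlace v w)))) * Matrix.diagonal ![1, (ϖ : (w.1.adicCompletion L))] := by simp only [Matrix.mul_assoc]
      _ = Matrix.diagonal ![1, (ϖ : (w.1.adicCompletion L))⁻¹] * ((s • (g : Matrix (Fin 2) (Fin 2) (v.adicCompletion ↥(maximalRealSubfield L))).map (toPlace v w)) * ((Matrix.diagonal ![1, (ϖ : (w.1.adicCompletion L))] * Matrix.diagonal ![1, (ϖ : (w.1.adicCompletion L))⁻¹]) *
            g₀.map (toPlace v w))) * Matrix.diagonal ![1, (ϖ : (w.1.adicCompletion L))] := by rw [hD', Matrix.one_mul, Matrix.one_mul, hιcomm]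
      _ = _ := by simp only [Matrix.mul_assoc]
  · -- conjugation preserves `U`
    rw [unitaryGroupOfForm_placeForm_antidiagTwo_eq] at hh ⊢
    exact conj_mem_unitaryGroupOfForm_of_similitude (galAdicCompletionMap (L := L) (IsCMField.complexConj L) hw) X₀ (by rw [hX₀coe, hXdef]; exact hsim) h hh

include hw in
/-- **RESIDUAL REPRESENTATIVES DOWNSTAIRS** (`𝓀_w = 𝓀_v` at a ramified place): every unit `c ∈ 𝒪_w` is `ι(p)` up to `𝔭_w` for a unit `p ∈ 𝒪_v` — write `c = ιp + ιq·ϖ`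
(★ `exists_eq_toPlace_add_toPlace_mul`). [cite: Serre1979, Ch. I §6 Prop. 18] [cite: NeukirchANT1999, Ch. II (6.8)] -/
theorem exists_toPlace_unit_near (he : v.asIdeal.ramificationIdx' w.1.asIdeal ≠ 1) {ϖ : (w.1.adicCompletion L)} (hϖ : Valued.v ϖ = WithZero.exp (-1 : ℤ))
    {c : (w.1.adicCompletion L)} (hc : Valued.v c = 1) :
    ∃ p : (v.adicCompletion ↥(maximalRealSubfield L)), valuation (v.adicCompletion ↥(maximalRealSubfield L)) p = 1 ∧ Valued.v (toPlace v w p - c) < 1 := by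
  obtain ⟨p, q, hpq⟩ := exists_eq_toPlace_add_toPlace_mul L v w hw he hϖ c
  have hmax := hc
  rw [hpq, valued_toPlace_add_toPlace_mul L v w hw he hϖ] at hmax
  have hq1 : Valued.v q ^ 2 * WithZero.exp (-1 : ℤ) < 1 := by
    have hle : Valued.v q ^ 2 * WithZero.exp (-1 : ℤ) ≤ 1 := le_trans (le_max_right _ _) hmax.le
    refine lt_of_le_of_ne hle fun h1 => ?_
    rcases eq_or_ne q 0 with hq0 | hq0
    · rw [hq0, map_zero, zero_pow two_ne_zero, zero_mul] at h1; exact zero_ne_one h1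
    · obtain ⟨n, hn⟩ : ∃ n : ℤ, Valued.v q = WithZero.exp n := ⟨_, (WithZero.exp_log ((Valuation.ne_zero_iff _).2 hq0)).symm⟩
      rw [hn, ← WithZero.exp_nsmul, ← WithZero.exp_add, ← WithZero.exp_zero, WithZero.exp_inj] at h1
      simp only [nsmul_eq_mul, Nat.cast_ofNat] at h1
      omega
  have hp1 : Valued.v p ^ 2 = 1 := by
    rcases le_total (Valued.v p ^ 2) (Valued.v q ^ 2 * WithZero.exp (-1 : ℤ)) with h | h
    · rw [max_eq_right h] at hmax; exact absurd hmax hq1.ne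
    · rw [max_eq_left h] at hmax; exact hmax
  have hp : Valued.v p = 1 := by
    rcases lt_trichotomy (Valued.v p) 1 with h | h | h
    · exact absurd hp1 (ne_of_lt (by simpa using pow_lt_one₀ zero_le h two_ne_zero))
    · exact h
    · exact absurd hp1 (ne_of_gt (by simpa using one_lt_pow₀ h two_ne_zero))
  refine ⟨p, (v_eq_one_iff_valuation_eq_one _).1 hp, ?_⟩
  rw [show toPlace v w p - c = -(toPlace v w q * ϖ) by rw [hpq]; ring, Valuation.map_neg, map_mul, valued_toPlace_eq_sq_of_ramified L v w hw he q, hϖ]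
  exact hq1

include hw in
/-- **THE CLASS FLIP FOR A PRESCRIBED CLASS UPSTAIRS.**  Same as `exists_classFlip_similitude_of_residue`, the residue of the unit multiplier `ι(ν)` being prescribed by ANY unit
`c ∈ 𝒪_w`: `|ι(ν) − c|_w < 1` (`𝓀_w = 𝓀_v`).  This is the similitude along which file 2b transports the residual classes `CLS_{c₀} ↔ CLS_{c₁}` (`c = c₀c₁⁻¹`).
[cite: LabesseLanglands1979, §2 p. 7] [cite: Rogawski1990, §4.9 p. 55] -/
theorem exists_classFlip_similitude_of_unit (he : v.asIdeal.ramificationIdx' w.1.asIdeal ≠ 1) (h2v : Valued.v (2 : (v.adicCompletion ↥(maximalRealSubfield L))) = 1)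
    (ϖ : (w.1.adicCompletion L)ˣ) (hϖ : Valued.v (ϖ : (w.1.adicCompletion L)) = WithZero.exp (-1 : ℤ))
    (hσϖ : galAdicCompletionMap (L := L) (IsCMField.complexConj L) hw (ϖ : (w.1.adicCompletion L)) = -(ϖ : (w.1.adicCompletion L)))
    (u : ↥(unitaryGroupOfForm (galAdicCompletionMap (L := L) (IsCMField.complexConj L) hw) (placeForm (Matrix.of fun i j : Fin 2 => if i.val + j.val + 1 = 2 then (1 : L) else 0) w.1)))
    {s : (w.1.adicCompletion L)} {g : GL (Fin 2) (v.adicCompletion ↥(maximalRealSubfield L))}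
    (hsg : Matrix.diagonal ![1, (ϖ : (w.1.adicCompletion L))] * ((u : GL (Fin 2) (w.1.adicCompletion L)) : Matrix (Fin 2) (Fin 2) (w.1.adicCompletion L)) * Matrix.diagonal ![1, (ϖ : (w.1.adicCompletion L))⁻¹] =
      s • (g : Matrix (Fin 2) (Fin 2) (v.adicCompletion ↥(maximalRealSubfield L))).map (toPlace v w))
    {ε₀ : (v.adicCompletion ↥(maximalRealSubfield L))} (hε₀ : ε₀ ∈ 𝒪[(v.adicCompletion ↥(maximalRealSubfield L))]) (hns : ∀ x : (v.adicCompletion ↥(maximalRealSubfield L)), x ∈ 𝒪[(v.adicCompletion ↥(maximalRealSubfield L))] → valuation (v.adicCompletion ↥(maximalRealSubfield L)) (x ^ 2 - ε₀) = 1)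
    {z : (v.adicCompletion ↥(maximalRealSubfield L))} (hz : z ≠ 0) (hD : (g : Matrix (Fin 2) (Fin 2) (v.adicCompletion ↥(maximalRealSubfield L))).trace ^ 2 - 4 * (g : Matrix (Fin 2) (Fin 2) (v.adicCompletion ↥(maximalRealSubfield L))).det = ε₀ * z ^ 2)
    {c : (w.1.adicCompletion L)} (hc : Valued.v c = 1) :
    ∃ (X₀ : GL (Fin 2) (w.1.adicCompletion L)) (ν : (v.adicCompletion ↥(maximalRealSubfield L))),
      ((X₀ : Matrix (Fin 2) (Fin 2) (w.1.adicCompletion L)).map (galAdicCompletionMap (L := L) (IsCMField.complexConj L) hw))ᵀ * !![(0 : (w.1.adicCompletion L)), 1; 1, 0] * (X₀ : Matrix (Fin 2) (Fin 2) (w.1.adicCompletion L)) =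
          toPlace v w ν • !![(0 : (w.1.adicCompletion L)), 1; 1, 0] ∧
      valuation (v.adicCompletion ↥(maximalRealSubfield L)) ν = 1 ∧ Valued.v (toPlace v w ν - c) < 1 ∧
      (X₀ : Matrix (Fin 2) (Fin 2) (w.1.adicCompletion L)) * ((u : GL (Fin 2) (w.1.adicCompletion L)) : Matrix (Fin 2) (Fin 2) (w.1.adicCompletion L)) = ((u : GL (Fin 2) (w.1.adicCompletion L)) : Matrix (Fin 2) (Fin 2) (w.1.adicCompletion L)) * (X₀ : Matrix (Fin 2) (Fin 2) (w.1.adicCompletion L)) ∧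
      ∀ h : GL (Fin 2) (w.1.adicCompletion L), h ∈ unitaryGroupOfForm (galAdicCompletionMap (L := L) (IsCMField.complexConj L) hw) (placeForm (Matrix.of fun i j : Fin 2 => if i.val + j.val + 1 = 2 then (1 : L) else 0) w.1) →
        X₀ * h * X₀⁻¹ ∈ unitaryGroupOfForm (galAdicCompletionMap (L := L) (IsCMField.complexConj L) hw) (placeForm (Matrix.of fun i j : Fin 2 => if i.val + j.val + 1 = 2 then (1 : L) else 0) w.1) := by
  obtain ⟨p, hp, hpc⟩ := exists_toPlace_unit_near L v w hw he hϖ hc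
  obtain ⟨X₀, ν, hsim, hν, hνp, hcomm, hnorm⟩ := exists_classFlip_similitude_of_residue L v w hw h2v ϖ hσϖ u hsg hε₀ hns hz hD hp
  refine ⟨X₀, ν, hsim, hν, ?_, hcomm, hnorm⟩
  have h1 : Valued.v (toPlace v w (ν - p)) < 1 := by
    rw [valued_toPlace_eq_sq_of_ramified L v w hw he, ← one_pow 2]
    exact pow_lt_pow_left₀ ((v_lt_one_iff_valuation_lt_one _).2 hνp) zero_le two_ne_zero
  rw [show toPlace v w ν - c = toPlace v w (ν - p) + (toPlace v w p - c) by rw [map_sub]; ring]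
  exact lt_of_le_of_lt (Valuation.map_add _ _ _) (max_lt h1 hpc)

/-! ## §4 The unitary correction: `latt X₀` is self-dual, so `k₀⁻¹X₀ ∈ GL₂(𝒪_w)` for some `k₀ ∈ U(σ_w, Φ₂)` -/

omit [IsCMField L] in
/-- `ι(ν)·J` is UNIMODULAR for a unit `ν` (`J = antidiag(1,1)`): integral entries, `det = −ι(ν)²` a unit. [cite: Jacobowitz1962, §7] -/
theorem isUnimodular₂_smul_antidiag {ν : (v.adicCompletion ↥(maximalRealSubfield L))} (hν : valuation (v.adicCompletion ↥(maximalRealSubfield L)) ν = 1) :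
    IsUnimodular₂ (toPlace v w ν • !![(0 : (w.1.adicCompletion L)), 1; 1, 0]) := by
  have hν1 : Valued.v (toPlace v w ν) = 1 := by rw [valued_toPlace, (v_eq_one_iff_valuation_eq_one _).2 hν, one_pow]
  have hνint : toPlace v w ν ∈ 𝒪[(w.1.adicCompletion L)] := (Valuation.mem_integer_iff _ _).2 ((v_eq_one_iff_valuation_eq_one _).1 hν1).le
  refine ⟨fun i j => ?_, ?_⟩
  · fin_cases i <;> fin_cases j <;> simp [hνint, zero_mem]
  · rw [Matrix.det_fin_two]
    simp only [Matrix.smul_apply, smul_eq_mul, Matrix.of_apply, Matrix.cons_val', Matrix.cons_val_zero, Matrix.cons_val_one, Matrix.cons_val_fin_one, Matrix.empty_val']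
    rw [show toPlace v w ν * 0 * (toPlace v w ν * 0) - toPlace v w ν * 1 * (toPlace v w ν * 1) = -(toPlace v w ν * toPlace v w ν) by ring, Valuation.map_neg, map_mul,
      (v_eq_one_iff_valuation_eq_one _).1 hν1, mul_one]

include hw in
/-- **THE UNITARY CORRECTION OF A UNIT-MULTIPLIER SIMILITUDE.**  If `ᵗσ_w(X₀)·J·X₀ = ι(ν)·J` with `|ν|_v = 1` then `latt X₀ = X₀·𝒪_w²` is a SELF-DUAL lattice (its Gram
matrix `ι(ν)J` is unimodular), so by the transitivity of `U(σ_w, Φ₂)` on self-dual lattices at a tame-ramified place (★ (hA) `forall_isSelfDualLattice_exists_latt_eq_of_ramified_antidiag`)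
there is `k₀ ∈ U(σ_w, Φ₂)` with `latt k₀ = latt X₀`, i.e. `k₀⁻¹·X₀ ∈ GL₂(𝒪_w)`. [cite: Jacobowitz1962, §8] [cite: BruhatTits1972, §10] -/
theorem exists_unitary_inv_mul_mem_glInt_of_similitude (he : v.asIdeal.ramificationIdx' w.1.asIdeal ≠ 1) (h2 : IsUnit (2 : 𝒪[(w.1.adicCompletion L)]))
    (X₀ : GL (Fin 2) (w.1.adicCompletion L)) {ν : (v.adicCompletion ↥(maximalRealSubfield L))} (hν : valuation (v.adicCompletion ↥(maximalRealSubfield L)) ν = 1)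
    (hX : ((X₀ : Matrix (Fin 2) (Fin 2) (w.1.adicCompletion L)).map (galAdicCompletionMap (L := L) (IsCMField.complexConj L) hw))ᵀ * !![(0 : (w.1.adicCompletion L)), 1; 1, 0] * (X₀ : Matrix (Fin 2) (Fin 2) (w.1.adicCompletion L)) =
      toPlace v w ν • !![(0 : (w.1.adicCompletion L)), 1; 1, 0]) :
    ∃ k₀ : GL (Fin 2) (w.1.adicCompletion L), k₀ ∈ unitaryGroupOfForm (galAdicCompletionMap (L := L) (IsCMField.complexConj L) hw) (placeForm (Matrix.of fun i j : Fin 2 => if i.val + j.val + 1 = 2 then (1 : L) else 0) w.1) ∧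
      k₀⁻¹ * X₀ ∈ glInt 2 (w.1.adicCompletion L) := by
  have hsd : IsSelfDualLattice (galAdicCompletionMap (L := L) (IsCMField.complexConj L) hw) (!![0, 1; 1, 0] : Matrix (Fin 2) (Fin 2) (w.1.adicCompletion L))
      (latt ((X₀ : GL (Fin 2) (w.1.adicCompletion L)) : Matrix (Fin 2) (Fin 2) (w.1.adicCompletion L))) := by
    refine ⟨X₀, rfl, ?_⟩
    show IsUnimodular₂ (((X₀ : Matrix (Fin 2) (Fin 2) (w.1.adicCompletion L)).map (galAdicCompletionMap (L := L) (IsCMField.complexConj L) hw))ᵀ * !![(0 : (w.1.adicCompletion L)), 1; 1, 0] * (X₀ : Matrix (Fin 2) (Fin 2) (w.1.adicCompletion L)))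
    rw [hX]
    exact isUnimodular₂_smul_antidiag L v w hν
  obtain ⟨k, hk⟩ := forall_isSelfDualLattice_exists_latt_eq_of_ramified_antidiag (IsCMField.complexConj L) w (IsCMField.complexConj_ne_one L) hw he h2 _ hsd
  refine ⟨(k : GL (Fin 2) (w.1.adicCompletion L)), ?_, (span_range_transpose_eq_iff (k : GL (Fin 2) (w.1.adicCompletion L)) X₀).1 hk⟩
  rw [unitaryGroupOfForm_placeForm_antidiagTwo_eq]
  exact k.2

end Flip

end Literature.NumberTheory.Automorphic.UnitaryGroup

end
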